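import Summits.Ventures.CertifiedManyBodySolver.Theorems.TcThermcert1QbpSeamLevels
import Literature.MathematicalPhysics.QuantumLattice.LatticeTori
import Mathlib
import HarnessLib

/-!
# Stub B of line `gauge_qbp_far_seam`, assembly part A: torus geometry of the collar and instance transport

Helper module (theorems only) for route `TcThermcert1`, cruxes K1′ `ThermalStiffnessCeilingU8b8_le_7o44`
(item `stmt-Ventures-24560`) and K1 `ThermalStiffnessCeilingU8b10_le_1o8` (item `stmt-Ventures-26381`), line
`Cruxes/…/Lines/gauge_qbp_far_seam.lean` v1.3, registered stub B `stub_farCutCurrent_of_clustering` (the port of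
Capel–Moscolari–Teufel–Wessel, arXiv:2310.09182, Thm 14, to the far-cut persistent current). First of four assembly files
(`…FarCutGeometry`, `…FarCutPerBond`, `…FarCutAsymptotics`, `…FarCutCurrentOfClustering`) on top of the landed QBP chain
`TcThermcert1Qbp*` (parts 1–6, 7a–7e):
* §1 geometry of the `L × L` torus: the collar `X_r = {x : |x₁|_∘ ≤ r}` (circular size of the first coordinate, as in part
  7e) contains the seam columns `x₁ ∈ {0,-1}` (`r ≥ 2`), misses both sites of every bond `(⌊L/2⌋-1, y)–(⌊L/2⌋, y)` of the
  antipodal cut once `r + 2 ≤ ⌊L/2⌋`, and every collar site is at torus distance `≥ ⌊L/2⌋ - 1 - r` from both ends of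
  such a bond (the `d` fed to Hypothesis C); `|Λ_L| = L²`; the seam-augmented index set has `≤ 4L⁴` elements.
* §2 instance transport: the torus files carry the shortcut instance `instDecidableEqFinsetOrbFermionTorus` while the
  generic CAR / sector lemmas and `carEvenSubalgebra` carry `Finset.decidableEq`; the two are equal by `Subsingleton.elim`,
  so subalgebra clauses (`E ∈ S` for all `S ∋ H, V`) and operator-norm bounds transport between the two forms.
SC in the Hubbard model is NOT proved by anything in this file; K1′/K1 are stiffness CEILINGS conditional on the bet C8.
-/

noncomputable section

open Filter Topology Set Real Matrix Finset MeasureTheory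
open scoped Matrix.Norms.L2Operator ComplexOrder ComplexConjugate
open Literature.MathematicalPhysics.QuantumLattice
open Literature.Probability.LatticeModels

namespace Summit.Ventures.CertifiedManyBodySolver.Theorems.TcThermcert1.GaugeQbpFarSeam

/-! ## §1 Torus geometry of the collar and of the antipodal cut -/

section Geometry

variable (L : ℕ) [NeZero L]

/-- The antipodal column `⌊L/2⌋` has circular size `⌊L/2⌋`. [folklore] -/
theorem natAbs_valMinAbs_half : (((L / 2 : ℕ) : ZMod L)).valMinAbs.natAbs = L / 2 := by
  have hL : 0 < L := Nat.pos_of_ne_zero (NeZero.ne L)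
  rw [ZMod.valMinAbs_natAbs_eq_min, ZMod.val_cast_of_lt (by omega : L / 2 < L)]
  omega

/-- The column left of the antipode has circular size `≥ ⌊L/2⌋ - 1`. [folklore] -/
theorem half_sub_one_le_natAbs_valMinAbs_half_sub_one :
    L / 2 - 1 ≤ (((L / 2 : ℕ) : ZMod L) - 1).valMinAbs.natAbs := by
  have h := natAbs_valMinAbs_add_one_le L ((((L / 2 : ℕ) : ZMod L)) - 1)
  rw [sub_add_cancel, natAbs_valMinAbs_half] at h
  omega

omit [NeZero L] in
/-- Reverse triangle inequality for the circular size: `|a|_∘ ≤ |b - a|_∘ + |b|_∘`. [folklore] -/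
theorem natAbs_valMinAbs_le_sub_add (a b : ZMod L) :
    a.valMinAbs.natAbs ≤ (b - a).valMinAbs.natAbs + b.valMinAbs.natAbs := by
  have h := (ZMod.natAbs_valMinAbs_add_le (-(b - a)) b).trans (Int.natAbs_add_le _ _)
  rw [show -(b - a) + b = a by ring, ZMod.natAbs_valMinAbs_neg] at h
  exact h

/-- The torus distance dominates the circular distance of the first coordinates. [folklore] -/
theorem natAbs_valMinAbs_fst_sub_le_torusDist (x : FermionTorus 2 L) (v : TorusSite 2 L) :
    (FermionTorus.toTorusSite x 0 - v 0).valMinAbs.natAbs ≤ torusDist x.toTorusSite v := by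
  unfold torusDist torusNorm
  rw [ZMod.valMinAbs_natAbs_eq_min]
  exact Finset.le_sup (f := fun i : Fin 2 => min ((x.toTorusSite - v) i).val (L - ((x.toTorusSite - v) i).val))
    (Finset.mem_univ (0 : Fin 2))

/-- A site of the collar `{|x₁|_∘ ≤ r}` is at torus distance `≥ ⌊L/2⌋ - 1 - r` from both ends of every bond of the
antipodal cut. [folklore] -/
theorem farBond_dist_of_mem_collar {r : ℕ} {x : FermionTorus 2 L}
    (hx : (FermionTorus.toTorusSite x 0).valMinAbs.natAbs ≤ r) (y : ZMod L) :
    L / 2 - 1 - r ≤ torusDist x.toTorusSite ![((L / 2 : ℕ) : ZMod L), y] ∧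
      L / 2 - 1 - r ≤ torusDist x.toTorusSite ![((L / 2 : ℕ) : ZMod L) - 1, y] := by
  constructor
  · refine le_trans ?_ (natAbs_valMinAbs_fst_sub_le_torusDist L x _)
    rw [Matrix.cons_val_zero]
    have h := natAbs_valMinAbs_le_sub_add L (((L / 2 : ℕ) : ZMod L)) (FermionTorus.toTorusSite x 0)
    rw [natAbs_valMinAbs_half] at h
    omega
  · refine le_trans ?_ (natAbs_valMinAbs_fst_sub_le_torusDist L x _)
    rw [Matrix.cons_val_zero]
    have h := natAbs_valMinAbs_le_sub_add L (((L / 2 : ℕ) : ZMod L) - 1) (FermionTorus.toTorusSite x 0)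
    have h2 := half_sub_one_le_natAbs_valMinAbs_half_sub_one L
    omega

/-- The two sites of a bond of the antipodal cut lie outside the collar `{|x₁|_∘ ≤ r}` once `r + 2 ≤ ⌊L/2⌋`. [folklore] -/
theorem disjoint_collar_farBond {r : ℕ} (hrL : r + 2 ≤ L / 2) (y : ZMod L) :
    Disjoint (Finset.univ.filter fun x : FermionTorus 2 L => (FermionTorus.toTorusSite x 0).valMinAbs.natAbs ≤ r)
      ({FermionTorus.ofTorusSite (![((L / 2 : ℕ) : ZMod L), y] : TorusSite 2 L),
        FermionTorus.ofTorusSite (![((L / 2 : ℕ) : ZMod L) - 1, y] : TorusSite 2 L)} : Finset (FermionTorus 2 L))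
            := by
  rw [Finset.disjoint_left]
  intro w hw hw'
  have hr := (Finset.mem_filter.1 hw).2
  simp only [Finset.mem_insert, Finset.mem_singleton] at hw'
  rcases hw' with rfl | rfl
  · rw [FermionTorus.toTorusSite_ofTorusSite, Matrix.cons_val_zero, natAbs_valMinAbs_half] at hr
    omega
  · rw [FermionTorus.toTorusSite_ofTorusSite, Matrix.cons_val_zero] at hr
    have h2 := half_sub_one_le_natAbs_valMinAbs_half_sub_one L
    omega

/-- The seam columns `x₁ ∈ {0, -1}` lie in every collar of radius `r ≥ 2`. [folklore] -/
theorem seamColumns_mem_collar {r : ℕ} (hr : 2 ≤ r) (y : ZMod L) :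
    FermionTorus.ofTorusSite (![0, y] : TorusSite 2 L) ∈
        (Finset.univ.filter fun x : FermionTorus 2 L => (FermionTorus.toTorusSite x 0).valMinAbs.natAbs ≤ r) ∧
      FermionTorus.ofTorusSite (![-1, y] : TorusSite 2 L) ∈
        (Finset.univ.filter fun x : FermionTorus 2 L => (FermionTorus.toTorusSite x 0).valMinAbs.natAbs ≤ r) := by
  refine ⟨Finset.mem_filter.2 ⟨Finset.mem_univ _, ?_⟩, Finset.mem_filter.2 ⟨Finset.mem_univ _, ?_⟩⟩
  · rw [FermionTorus.toTorusSite_ofTorusSite, Matrix.cons_val_zero, ZMod.valMinAbs_zero]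
    exact Nat.zero_le _
  · rw [FermionTorus.toTorusSite_ofTorusSite, Matrix.cons_val_zero]
    exact (natAbs_valMinAbs_neg_one_le L).trans (by omega)

omit [NeZero L] in
/-- `|FermionTorus 2 L| = L²`. [folklore] -/
theorem card_fermionTorus_two : Fintype.card (FermionTorus 2 L) = L ^ 2 := by
  change Fintype.card (Fin 2 → Fin L) = L ^ 2
  rw [Fintype.card_fun, Fintype.card_fin, Fintype.card_fin]

/-- The seam-augmented index set of the `L × L` torus has at most `4L⁴` elements (crude). [folklore] -/
theorem card_seamAugmentedIdx_le :
    (Fintype.card (HubbardIdx (fermionTorusGraph 2 L) ⊕ (ZMod L × Fin 2)) : ℝ) ≤ 4 * (L : ℝ) ^ 4 := by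
  have hL : 1 ≤ L := Nat.pos_of_ne_zero (NeZero.ne L)
  have h1 : Fintype.card (HubbardIdx (fermionTorusGraph 2 L) ⊕ (ZMod L × Fin 2)) ≤
      L ^ 2 * L ^ 2 + L ^ 2 + L * 2 := by
    have hA : Fintype.card {q : FermionTorus 2 L × FermionTorus 2 L // (fermionTorusGraph 2 L).Adj q.1 q.2} ≤
        L ^ 2 * L ^ 2 := by
      refine (Fintype.card_subtype_le _).trans ?_
      rw [Fintype.card_prod, card_fermionTorus_two]
    have hB : Fintype.card (HubbardIdx (fermionTorusGraph 2 L)) ≤ L ^ 2 * L ^ 2 + L ^ 2 := by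
      refine (le_of_eq (Fintype.card_sum ..)).trans ?_
      rw [card_fermionTorus_two]
      exact Nat.add_le_add_right hA _
    refine (le_of_eq (Fintype.card_sum ..)).trans ?_
    rw [Fintype.card_prod, ZMod.card, Fintype.card_fin]
    exact Nat.add_le_add_right hB _
  have h2 : ((Fintype.card (HubbardIdx (fermionTorusGraph 2 L) ⊕ (ZMod L × Fin 2)) : ℕ) : ℝ) ≤
      ((L ^ 2 * L ^ 2 + L ^ 2 + L * 2 : ℕ) : ℝ) := by exact_mod_cast h1
  refine h2.trans ?_
  push_cast
  have hL1 : (1 : ℝ) ≤ L := by exact_mod_cast hL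
  nlinarith [pow_le_pow_right₀ hL1 (show 2 ≤ 4 by norm_num), pow_le_pow_right₀ hL1 (show 1 ≤ 4 by norm_num),
    pow_one (L : ℝ)]

end Geometry

/-! ## §2 Instance transport (the tree carries two `DecidableEq (Finset (Orb _))` instances on the torus) -/

/-- **Subalgebra clauses do not depend on the `DecidableEq` instance of the matrix ring.** The QBP conjugations are
produced (part 6) with the torus' shortcut instance, while the even CAR subalgebras and the generic sector lemmas carry
`Finset.decidableEq`; the two instances are equal (`Subsingleton`), so membership clauses transport. [folklore] -/
theorem forall_subalgebra_mem_of_subsingleton {ι : Type*} [Fintype ι] {d₁ d₂ : DecidableEq ι}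
    {H V E : Matrix ι ι ℂ}
    (hE : ∀ S : @Subalgebra ℂ (Matrix ι ι ℂ) _ (@Matrix.semiring ι ℂ _ _ d₁) (@Matrix.instAlgebra ι ℂ ℂ _ d₁ _ _ _),
      H ∈ S → V ∈ S → E ∈ S)
    (S : @Subalgebra ℂ (Matrix ι ι ℂ) _ (@Matrix.semiring ι ℂ _ _ d₂) (@Matrix.instAlgebra ι ℂ ℂ _ d₂ _ _ _))
    (hH : H ∈ S) (hV : V ∈ S) : E ∈ S := by
  obtain rfl : d₁ = d₂ := Subsingleton.elim _ _
  exact hE S hH hV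

/-- **Operator-norm bounds do not depend on the `DecidableEq` instance** entering the `ℓ²`-operator norm of matrices
(same transport, for the generic CAR size lemmas). [folklore] -/
theorem norm_le_of_subsingleton {ι : Type*} [Fintype ι] {d₁ : DecidableEq ι} {A : Matrix ι ι ℂ} {c : ℝ}
    (h : ‖A‖ ≤ c) {d₂ : DecidableEq ι} : ‖A‖ ≤ c := by
  obtain rfl : d₁ = d₂ := Subsingleton.elim _ _
  exact h

end Summit.Ventures.CertifiedManyBodySolver.Theorems.TcThermcert1.GaugeQbpFarSeam

end
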